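import Summits.ResolutionOfSingularities.ResolutionOfSingularities.Theorems.WildQuotientsSummitReductionStubPairOrbitNormalFormBlowupModelCharts5
import HarnessLib

/-!
# `WildQuotients.SummitReduction` (stmt-ResolutionOfSingularities-16324), line `FramePerfect`, stub NB1
# (`stub_pair_orbitNormalFormBlowup_modelSingularOverCentre`): chart `z_a ≠ 0` — the non-regular
# points lie on the strict transforms of the other branches

Route `ResolutionOfSingularities/WildQuotients`, crux `SummitReduction`; sixth helper file of
stub NB1 = de Jong 1996, Claim 4.27 [C1] on the coefficient-free model. Assembly of
`…OrbitNormalFormBlowupModelCharts3/4/5.lean` on the chart `z_a ≠ 0`: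

* **`exists_prime_le_chartT`** — for `R` regular local, `z` part of a regular system of
  parameters, the centre `(z ∘ ι)`, further branches `S` and
  `F = z_{ι0} z_{ι1} - z_{ι2} z_{ι3} ∏_S z`: if `𝔮 ∋ z̄_{ι2}` is a prime of the chart
  `(R/(F))[Ī/z̄_{ι2}]` of the blow-up of `R/(F)` in `I = (z ∘ ι)` at which the chart is not
  regular, then `𝔮` lies over a prime `𝔯 ∌ z̄_{ι2}` containing `(z_{ι0}, z_{ι1}, z_p, z_q)` for
  two further branches `p ≠ q` (`p = ι 3` or `p ∈ S`, `q ∈ S`) — i.e. the point lies on the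
  strict transform of `V(z_{ι0}, z_{ι1}, z_p, z_q)`: transport to the ambient chart
  (`exists_mul_mem_sq_comap_of_surjective`), the memberships
  (`mem_of_mul_strictTransformT_mem_sq`), the test primes of cases A/B, and push-forward
  (`isPrime_map_of_surjective_of_mem`);
* `isRegularLocalRing_chartU_of_eq`, `exists_prime_le_chartT_of_eq` — the chart theorems with
  the chart element and the centre ideal given up to equality (for the specialisation to the
  model).

## Sources

* A. J. de Jong, *Smoothness, semi-stability and alterations*, Publ. Math. IHÉS 83 (1996), 4.27,
  p. 76. [DeJong1996]
* A. J. de Jong, *Families of curves and alterations*, Ann. Inst. Fourier 47 (1997), proof of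
  Prop. 5.11, p. 619. [DeJong1997]
-/

set_option linter.dupNamespace false -- the tree's summit namespace repeats `ResolutionOfSingularities`

noncomputable section

open IsLocalRing

namespace Summit.ResolutionOfSingularities.ResolutionOfSingularities.Theorems

open Literature.AlgebraicGeometry.Resolution

section Concrete

variable {R : Type} [CommRing R] [IsLocalRing R] {N : ℕ} {z : Fin N → R} (hz : IsRsopPart z)
  {ι : Fin 4 → Fin N} (hι : Function.Injective ι)

/-! ## Assembly on the chart `z_a ≠ 0` -/

include hz in
/-- A member `z_i` off an injective sub-family `z ∘ κ` does not lie in its ideal. [folklore] -/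
theorem notMem_span_range_comp {n : ℕ} {κ : Fin n → Fin N} {i : Fin N} (hi : i ∉ Set.range κ) :
    z i ∉ Ideal.span (Set.range (z ∘ κ)) := by
  rw [Set.range_comp]
  exact hz.not_mem_span_image hi

omit [IsLocalRing R] in
/-- `z_k ∣ h = ∏_{S} z` for `k ∈ S`, so `h` lies in every ideal containing `z_k`. [folklore] -/
theorem prod_mem_of_mem {S : Finset (Fin N)} {k : Fin N} (hk : k ∈ S) {K : Ideal R} (hkK : z k ∈ K) :
    ∏ k ∈ S, z k ∈ K := by
  obtain ⟨c, hc⟩ := Finset.dvd_prod_of_mem z hk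
  rw [hc]
  exact K.mul_mem_right c hkK

end Concrete

/-- **Chart `z_a ≠ 0`: the non-regular points lie on the strict transforms of the other
branches** — coefficient-free form of de Jong 1996, 4.27 [C1] on the chart "`t₁ ≠ 0`" ("Clearly
the singularities are of the type described in (ii). The irreducible component
`u' = v' = t₂' = t₃ = 0` of the singular locus maps onto `u = v = t₂ = t₃ = 0`, the component
`u' = v' = t₃ = t₄ = 0` is the strict transform of the component `u = v = t₃ = t₄ = 0`"): for
`R` regular local, `z` part of a regular system of parameters, the centre `(z ∘ ι)`, further
branches `S` and `F = z_{ι0} z_{ι1} - z_{ι2} z_{ι3} ∏_S z`, if `𝔮 ∋ z̄_{ι2}` is a prime of the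
chart `(R/(F))[Ī/z̄_{ι2}]` of the blow-up of `R/(F)` at which it is not regular, then `𝔮` lies
over a prime `𝔯 ∌ z̄_{ι2}` containing `(z_{ι0}, z_{ι1}, z_p, z_q)` for two further branches
`p ≠ q` (`p = ι 3` or `p ∈ S`, `q ∈ S`) — a point of the strict transform of `V(z_{ι0}, z_{ι1}, z_p, z_q)`.
[cite: DeJong1996, 4.27, p. 76] [cite: DeJong1997, proof of Prop. 5.11, p. 619] -/
theorem exists_prime_le_chartT {R : Type} [CommRing R] [IsLocalRing R] {N : ℕ} {z : Fin N → R}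
    (hz : IsRsopPart z) {ι : Fin 4 → Fin N} (hι : Function.Injective ι) {S : Finset (Fin N)} (hS : ∀ k ∈ S, k ∉ Set.range ι) {h : R}
    (hh : h = ∏ k ∈ S, z k) {F : R} (hF : F = z (ι 0) * z (ι 1) - z (ι 2) * z (ι 3) * h)
    (𝔮 : Ideal (blowupAlgebra ((Ideal.span (Set.range (z ∘ ι))).map (Ideal.Quotient.mk (Ideal.span {F})))
      (Ideal.Quotient.mk (Ideal.span {F}) ((z ∘ ι) 2)))) [𝔮.IsPrime]
    (h2 : algebraMap (R ⧸ Ideal.span {F}) _ (Ideal.Quotient.mk (Ideal.span {F}) ((z ∘ ι) 2)) ∈ 𝔮)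
    (h𝔮 : ¬ IsRegularLocalRing (Localization.AtPrime 𝔮)) :
    ∃ p q : Fin N, p ≠ q ∧ (p = ι 3 ∨ p ∈ S) ∧ q ∈ S ∧
      ∃ 𝔯 : Ideal (blowupAlgebra ((Ideal.span (Set.range (z ∘ ι))).map (Ideal.Quotient.mk (Ideal.span {F})))
        (Ideal.Quotient.mk (Ideal.span {F}) ((z ∘ ι) 2))), 𝔯.IsPrime ∧ 𝔯 ≤ 𝔮 ∧
        algebraMap (R ⧸ Ideal.span {F}) _ (Ideal.Quotient.mk (Ideal.span {F}) ((z ∘ ι) 2)) ∉ 𝔯 ∧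
        ((Ideal.span {z (ι 0), z (ι 1), z p, z q}).map (Ideal.Quotient.mk (Ideal.span {F}))).map
          (algebraMap (R ⧸ Ideal.span {F}) _) ≤ 𝔯 := by
  haveI := isRegularRing_chart hz hι 2
  have hsurj := blowupAlgebra.mapQuotient_surjective (Ideal.span (Set.range (z ∘ ι))) ((z ∘ ι) 2)
    (Ideal.span {F})
  have hker := ker_mapQuotient_chartT hz hι hF
  have hQ2 := (algebraMap_mem_comap_mapQuotient_iff (Ideal.span (Set.range (z ∘ ι))) ((z ∘ ι) 2) F 𝔮
    ((z ∘ ι) 2)).mpr h2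
  obtain ⟨w, hw, hwF⟩ := exists_mul_mem_sq_comap_of_surjective _ hsurj _ hker 𝔮 h𝔮
  obtain ⟨hu, hv, k, hkS, hkQ, hcase⟩ := mem_of_mul_strictTransformT_mem_sq hz hι hS hh _ hQ2 hw hwF
  have hkι : k ∉ Set.range ι := hS k hkS
  -- push-forward of a suitable prime `𝔯 ≤ φ⁻¹𝔮` of `R[I/z_a]`
  have push : ∀ (p q : Fin N) (𝔯 : Ideal (blowupAlgebra (Ideal.span (Set.range (z ∘ ι))) ((z ∘ ι) 2))),
      𝔯.IsPrime → 𝔯 ≤ 𝔮.comap (blowupAlgebra.mapQuotient (Ideal.span (Set.range (z ∘ ι))) ((z ∘ ι) 2)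
        (Ideal.span {F})) →
      blowupAlgebra.frac (z ∘ ι) 2 0 * blowupAlgebra.frac (z ∘ ι) 2 1 -
        blowupAlgebra.frac (z ∘ ι) 2 3 * algebraMap R _ h ∈ 𝔯 →
      algebraMap R _ ((z ∘ ι) 2) ∉ 𝔯 →
      (Ideal.span {z (ι 0), z (ι 1), z p, z q}).map (algebraMap R _) ≤ 𝔯 →
      ∃ 𝔯' : Ideal (blowupAlgebra ((Ideal.span (Set.range (z ∘ ι))).map (Ideal.Quotient.mk (Ideal.span {F})))
        (Ideal.Quotient.mk (Ideal.span {F}) ((z ∘ ι) 2))), 𝔯'.IsPrime ∧ 𝔯' ≤ 𝔮 ∧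
        algebraMap (R ⧸ Ideal.span {F}) _ (Ideal.Quotient.mk (Ideal.span {F}) ((z ∘ ι) 2)) ∉ 𝔯' ∧
        ((Ideal.span {z (ι 0), z (ι 1), z p, z q}).map (Ideal.Quotient.mk (Ideal.span {F}))).map
          (algebraMap (R ⧸ Ideal.span {F}) _) ≤ 𝔯' := by
    intro p q 𝔯 h𝔯p h𝔯Q hF𝔯 ha𝔯 hK𝔯
    obtain ⟨hp', hle, hnot⟩ := isPrime_map_of_surjective_of_mem _ _ hker hsurj 𝔮 𝔯 h𝔯Q hF𝔯 ha𝔯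
    refine ⟨_, hp', hle, ?_, ?_⟩
    · rwa [blowupAlgebra.mapQuotient_algebraMap] at hnot
    · rw [← map_mapQuotient_map_algebraMap]
      exact Ideal.map_mono hK𝔯
  rcases hcase with h3 | ⟨k', hk'S, hk'k, hk'Q⟩
  · -- case A: `e₃ ∈ Q`, the strict transform of `V(z_u, z_v, z_b, z_k)`
    have hκ : Function.Injective (Fin.cons k (ι ∘ Fin.succAbove 2) : Fin 4 → Fin N) := by
      refine Fin.cons_injective_iff.mpr ⟨?_, hι.comp Fin.succAbove_right_injective⟩
      rintro ⟨j, hj⟩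
      exact hkι ⟨_, hj⟩
    haveI := (hz.comp _ hκ).isPrime_span_range
    have ha : (z ∘ ι) 2 ∉ Ideal.span (Set.range (z ∘ Fin.cons k (ι ∘ Fin.succAbove 2))) := by
      refine notMem_span_range_comp hz ?_
      rintro ⟨j, hj⟩
      refine Fin.cases ?_ (fun j => ?_) j hj
      · intro h0
        exact hkι ⟨2, h0.symm⟩
      · intro h0
        rw [Fin.cons_succ, Function.comp_apply] at h0
        exact Fin.succAbove_ne 2 j (hι h0)
    have hgen : ∀ g ∈ ({z (ι 0), z (ι 1), z (ι 3), z k} : Set R),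
        g ∈ Ideal.span (Set.range (z ∘ Fin.cons k (ι ∘ Fin.succAbove 2))) := by
      rintro g (rfl | rfl | rfl | rfl)
      · exact Ideal.subset_span ⟨1, rfl⟩
      · exact Ideal.subset_span ⟨2, rfl⟩
      · exact Ideal.subset_span ⟨3, rfl⟩
      · exact Ideal.subset_span ⟨0, rfl⟩
    have hθ0 : ∀ g ∈ Ideal.span (Set.range (z ∘ Fin.cons k (ι ∘ Fin.succAbove 2))),
        Localization.awayLift ((algebraMap _ (FractionRing (R ⧸ Ideal.span (Set.range
          (z ∘ Fin.cons k (ι ∘ Fin.succAbove 2)))))).comp (Ideal.Quotient.mk _)) ((z ∘ ι) 2)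
          (isUnit_test_comp_mk _ ha) (algebraMap R (Localization.Away ((z ∘ ι) 2)) g) = 0 := fun g hg => by
      rw [awayLift_algebraMap _ ha, test_comp_mk_eq_zero_iff]
      exact hg
    refine ⟨ι 3, k, fun h0 => hkι ⟨3, h0⟩, Or.inl rfl, hkS, ?_⟩
    refine push (ι 3) k _ (isPrime_testPrime _) (testPrime_le_caseA _ hQ2 hu hv h3 hkQ ha)
      (strictTransformT_mem_testPrime _ (hθ0 _ (hgen _ (by simp))) (hθ0 _ ?_))
      (algebraMap_centre_notMem_testPrime _) (map_span_le_testPrime _ fun g hg => hθ0 g (hgen g hg))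
    rw [hh]
    exact prod_mem_of_mem hkS (hgen _ (by simp))
  · -- case B: a second branch `z_{k'} ∈ Q`, the strict transform of `V(z_u, z_v, z_k, z_{k'})`
    have hk'ι : k' ∉ Set.range ι := hS k' hk'S
    have hκ : Function.Injective (Fin.cons k (Fin.cons k' (ι ∘ Fin.castAdd 2)) : Fin 4 → Fin N) := by
      refine Fin.cons_injective_iff.mpr ⟨?_, Fin.cons_injective_iff.mpr ⟨?_, hι.comp (Fin.castAdd_injective 2 2)⟩⟩
      · rintro ⟨j, hj⟩
        refine Fin.cases ?_ (fun j => ?_) j hj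
        · intro h0
          exact hk'k h0
        · intro h0
          exact hkι ⟨_, h0⟩
      · rintro ⟨j, hj⟩
        exact hk'ι ⟨_, hj⟩
    have hrange : ∀ (i : Fin N), i ∈ Set.range (Fin.cons k (Fin.cons k' (ι ∘ Fin.castAdd 2)) : Fin 4 → Fin N) →
        i = k ∨ i = k' ∨ ∃ j : Fin 2, i = ι (Fin.castAdd 2 j) := by
      rintro i ⟨j, rfl⟩
      refine Fin.cases (Or.inl rfl) (fun j => Fin.cases (Or.inr (Or.inl rfl)) (fun j => ?_) j) j
      exact Or.inr (Or.inr ⟨j, rfl⟩)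
    haveI := (hz.comp _ hκ).isPrime_span_range
    have h2r : ι 2 ∉ Set.range (Fin.cons k (Fin.cons k' (ι ∘ Fin.castAdd 2)) : Fin 4 → Fin N) := by
      intro hmem
      rcases hrange _ hmem with h0 | h0 | ⟨j, h0⟩
      · exact hkι ⟨2, h0⟩
      · exact hk'ι ⟨2, h0⟩
      · have := congrArg Fin.val (hι h0)
        simp only [Fin.val_castAdd] at this
        have := j.isLt
        omega
    have ha : (z ∘ ι) 2 ∉ Ideal.span (Set.range (z ∘ Fin.cons k (Fin.cons k' (ι ∘ Fin.castAdd 2)))) :=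
      notMem_span_range_comp hz h2r
    have hκ5 : Function.Injective (Fin.cons (ι 2) (Fin.cons k (Fin.cons k' (ι ∘ Fin.castAdd 2))) :
        Fin 5 → Fin N) := Fin.cons_injective_iff.mpr ⟨h2r, hκ⟩
    haveI := (hz.comp _ hκ5).isPrime_span_range
    have hb : (z ∘ ι) 3 ∉ Ideal.span (Set.range (z ∘ Fin.cons (ι 2)
        (Fin.cons k (Fin.cons k' (ι ∘ Fin.castAdd 2))))) := by
      refine notMem_span_range_comp hz ?_
      rintro ⟨j, hj⟩
      refine Fin.cases ?_ (fun j => ?_) j hj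
      · intro h0
        exact absurd (hι h0) (by decide)
      · intro h0
        rw [Fin.cons_succ] at h0
        rcases hrange _ ⟨j, h0⟩ with h1 | h1 | ⟨j', h1⟩
        · exact hkι ⟨3, h1⟩
        · exact hk'ι ⟨3, h1⟩
        · have := congrArg Fin.val (hι h1)
          simp only [Fin.val_castAdd] at this
          have := j'.isLt
          omega
    have hgen : ∀ g ∈ ({z (ι 0), z (ι 1), z k, z k'} : Set R),
        g ∈ Ideal.span (Set.range (z ∘ Fin.cons k (Fin.cons k' (ι ∘ Fin.castAdd 2)))) := by
      rintro g (rfl | rfl | rfl | rfl)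
      · exact Ideal.subset_span ⟨2, rfl⟩
      · exact Ideal.subset_span ⟨3, rfl⟩
      · exact Ideal.subset_span ⟨0, rfl⟩
      · exact Ideal.subset_span ⟨1, rfl⟩
    have hθ0 : ∀ g ∈ Ideal.span (Set.range (z ∘ Fin.cons k (Fin.cons k' (ι ∘ Fin.castAdd 2)))),
        Localization.awayLift ((algebraMap _ (FractionRing (R ⧸ Ideal.span (Set.range
          (z ∘ Fin.cons k (Fin.cons k' (ι ∘ Fin.castAdd 2))))))).comp (Ideal.Quotient.mk _)) ((z ∘ ι) 2)
          (isUnit_test_comp_mk _ ha) (algebraMap R (Localization.Away ((z ∘ ι) 2)) g) = 0 := fun g hg => by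
      rw [awayLift_algebraMap _ ha, test_comp_mk_eq_zero_iff]
      exact hg
    refine ⟨k, k', fun h0 => hk'k h0.symm, Or.inr hkS, hk'S, ?_⟩
    refine push k k' _ (isPrime_testPrime _) (testPrime_le_caseB _ hQ2 hu hv hkQ hk'Q ha hb)
      (strictTransformT_mem_testPrime _ (hθ0 _ (hgen _ (by simp))) (hθ0 _ ?_))
      (algebraMap_centre_notMem_testPrime _) (map_span_le_testPrime _ fun g hg => hθ0 g (hgen g hg))
    rw [hh]
    exact prod_mem_of_mem hkS (hgen _ (by simp))

/-! ## Transport of the chart theorems along equalities of the chart data -/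

section OfEq

variable {R : Type} [CommRing R] [IsLocalRing R] {N : ℕ} {z : Fin N → R} (hz : IsRsopPart z)
  {ι : Fin 4 → Fin N} (hι : Function.Injective ι) {S : Finset (Fin N)}
  (hS : ∀ k ∈ S, k ∉ Set.range ι) {h : R} (hh : h = ∏ k ∈ S, z k) {F : R}
  (hF : F = z (ι 0) * z (ι 1) - z (ι 2) * z (ι 3) * h)

include hz hι hF in
/-- `isRegularLocalRing_chartU` with the chart element and the centre ideal given up to
equality. [cite: DeJong1996, 4.27, p. 76] -/
theorem isRegularLocalRing_chartU_of_eq {b : R} (hb : (z ∘ ι) 0 = b)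
    {J : Ideal (R ⧸ Ideal.span {F})}
    (hJ : (Ideal.span (Set.range (z ∘ ι))).map (Ideal.Quotient.mk (Ideal.span {F})) = J)
    (𝔮 : Ideal (blowupAlgebra J (Ideal.Quotient.mk (Ideal.span {F}) b))) [𝔮.IsPrime]
    (h0 : algebraMap (R ⧸ Ideal.span {F}) _ (Ideal.Quotient.mk (Ideal.span {F}) b) ∈ 𝔮) :
    IsRegularLocalRing (Localization.AtPrime 𝔮) := by
  subst hb hJ
  exact isRegularLocalRing_chartU hz hι hF 𝔮 h0

include hz hι hS hh hF in
/-- `exists_prime_le_chartT` with the chart element and the centre ideal given up to equality.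
[cite: DeJong1996, 4.27, p. 76] -/
theorem exists_prime_le_chartT_of_eq {b : R} (hb : (z ∘ ι) 2 = b)
    {J : Ideal (R ⧸ Ideal.span {F})}
    (hJ : (Ideal.span (Set.range (z ∘ ι))).map (Ideal.Quotient.mk (Ideal.span {F})) = J)
    (𝔮 : Ideal (blowupAlgebra J (Ideal.Quotient.mk (Ideal.span {F}) b))) [𝔮.IsPrime]
    (h2 : algebraMap (R ⧸ Ideal.span {F}) _ (Ideal.Quotient.mk (Ideal.span {F}) b) ∈ 𝔮)
    (h𝔮 : ¬ IsRegularLocalRing (Localization.AtPrime 𝔮)) :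
    ∃ p q : Fin N, p ≠ q ∧ (p = ι 3 ∨ p ∈ S) ∧ q ∈ S ∧
      ∃ 𝔯 : Ideal (blowupAlgebra J (Ideal.Quotient.mk (Ideal.span {F}) b)), 𝔯.IsPrime ∧ 𝔯 ≤ 𝔮 ∧
        algebraMap (R ⧸ Ideal.span {F}) _ (Ideal.Quotient.mk (Ideal.span {F}) b) ∉ 𝔯 ∧
        ((Ideal.span {z (ι 0), z (ι 1), z p, z q}).map (Ideal.Quotient.mk (Ideal.span {F}))).map
          (algebraMap (R ⧸ Ideal.span {F}) _) ≤ 𝔯 := by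
  subst hb hJ
  exact exists_prime_le_chartT hz hι hS hh hF 𝔮 h2 h𝔮

end OfEq

end Summit.ResolutionOfSingularities.ResolutionOfSingularities.Theorems

end
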